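import Summits.FinalStateConjecture.FinalStateConjecture.Theorems.EIHFluxBalanceInertialRecessionStubHigherOrderJetCompare
import Summits.FinalStateConjecture.FinalStateConjecture.Theorems.EIHFluxBalanceInertialRecessionStubHigherOrderApplyCB
import Summits.FinalStateConjecture.FinalStateConjecture.Theorems.EIHFluxBalanceInertialRecessionStubHigherOrderOmega
import Literature.Geometry.Lorentzian.ExtensionProofs

/-!
# Route EIHFluxBalance — `InertialRecession` (E′), line `SketchCleanExcision`, skeleton r13,
# stub `stub_higherOrderSlaving` (EF): the second-order step at one late time

Helper file for the crux `stmt-FinalStateConjecture-17403`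
(`Summit.FinalStateConjecture.FinalStateConjecture.Theses.EIHFluxBalance.InertialRecession`, E′),
registered stub `stub_higherOrderSlaving` (orders two and three of frozen-vacuum slaving).

`higherOrder_rstep_point`: at a late time `t`, the coercivity clause of `stub_coerSymbolQuant`
(hypotheses `hshell`, `hcoer`) applied to the re-centred frozen ansatz `w ↦ g₀(w + cᵢ(t))` and the
re-centred second variation (`…StubHigherOrderApplyCB`) bounds `c₀ · red₂ᵢ(t)` by the modelling
error of the second variation (`…StubHigherOrderJetBounds`), the Ricci form of the ansatz
(hypothesis `hrrc`, clause (RR) of the crux) and the Ricci form of the ansatz with the second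
variation removed, compared through its jets with the frozen own summand
(`…StubHigherOrderJetCompare`). Everything is linear in the second-order sizes of all holes, with
coefficients that are small at late times.

No definitions, no named facts, no `sorry`.
-/

set_option linter.dupNamespace false
set_option maxSynthPendingDepth 6
set_option synthInstance.maxHeartbeats 200000

noncomputable section

namespace Summit.FinalStateConjecture.FinalStateConjecture.Theorems.SublinearIsFree.Slaving

open scoped Topology ContDiff BigOperators
open Filter Set Function Metric Literature.Geometry.Lorentzian
  Summit.FinalStateConjecture.FinalStateConjecture.Theorems
open MetricCoord

/-- **Registered one-line carrier form** (`higherOrder_absTime_EF`): the time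
component is bounded by the Euclidean norm (`C0Extension.abs_apply_zero_le_norm`). [folklore] -/
theorem higherOrder_absTime_EF : ∀ v : E4, |v 0| ≤ ‖v‖ :=
  fun v ↦ Literature.Geometry.Lorentzian.C0Extension.abs_apply_zero_le_norm v

set_option maxHeartbeats 6400000 in
/-- **The second-order step at one late time (pointwise, abstract form).** See the module
docstring: `g₀` is the frozen ansatz, `G₀`, `P₁`, `P₂` its frozen field and variation fields at
the frozen time `t` (hypothesis `hslice`), `Λc`, `ξc` the painted frame and centre of hole `i`,
`L` a representative frame at `t` painting the same radius, `A'`, `d₂` any skew rate and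
translation; the far holes enter only through the scalars `Dsum`, `SE₁`, `S₂`, `Werr` of the jet
bounds (hypothesis `hJ`, from `…StubHigherOrderJetBounds`). [folklore] -/
theorem higherOrder_rstep_point {Mᵢ aᵢ γ : ℝ} (hMi : 0 < Mᵢ) {c₀ ρin ρout η₀ : ℝ}
    (hshell : ∀ (L : lorentzGroup) (y : E3), |((L : E4 ≃L[ℝ] E4) (E4.basisVector 0)) 0| ≤ γ → ρin ≤ ‖y‖ → 2 * Mᵢ < Kerr.radius aᵢ (poincareInv L 0 (E4.ofTimeSpace 0 y)))
    (hcoer : ∀ (L : lorentzGroup) (A : E4 →L[ℝ] E4) (d : E4) (G G' : E4 → E4 →L[ℝ] E4 →L[ℝ] ℝ) (V : Set E4),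
      |((L : E4 ≃L[ℝ] E4) (E4.basisVector 0)) 0| ≤ γ →
      (∀ u w : E4, Minkowski.bilin (A u) w + Minkowski.bilin u (A w) = 0) →
      MetricCoord.IsMetricOn G V → MetricCoord.IsMetricOn G' V →
      (∀ y : E3, ρin ≤ ‖y‖ → ‖y‖ ≤ ρout → (E4.ofTimeSpace 0 y) ∈ V ∧
        ‖G (E4.ofTimeSpace 0 y) - boostedKerrBilin L 0 Mᵢ aᵢ (E4.ofTimeSpace 0 y)‖ ≤ η₀ ∧
        G' (E4.ofTimeSpace 0 y) = G (E4.ofTimeSpace 0 y) ∧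
        fderiv ℝ G' (E4.ofTimeSpace 0 y) = fderiv ℝ G (E4.ofTimeSpace 0 y) ∧
        ∀ v : E4, fderiv ℝ (fderiv ℝ G') (E4.ofTimeSpace 0 y) v =
          fderiv ℝ (fderiv ℝ G) (E4.ofTimeSpace 0 y) v + (v 0) • (E4.dx 0).smulRight
            ((fderiv ℝ (Kerr.bilin Mᵢ aᵢ) (poincareInv L 0 (E4.ofTimeSpace 0 y)) (A (poincareInv L 0 (E4.ofTimeSpace 0 y)) + d)).bilinearComp (((L : E4 ≃L[ℝ] E4).symm : E4 →L[ℝ] E4)) (((L : E4 ≃L[ℝ] E4).symm : E4 →L[ℝ] E4)) + (Kerr.bilin Mᵢ aᵢ (poincareInv L 0 (E4.ofTimeSpace 0 y))).bilinearComp ((A).comp (((L : E4 ≃L[ℝ] E4).symm : E4 →L[ℝ] E4))) (((L : E4 ≃L[ℝ] E4).symm : E4 →L[ℝ] E4)) + (Kerr.bilin Mᵢ aᵢ (poincareInv L 0 (E4.ofTimeSpace 0 y))).bilinearComp (((L : E4 ≃L[ℝ] E4).symm : E4 →L[ℝ] E4)) ((A).comp (((L : E4 ≃L[ℝ] E4).symm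 : E4 →L[ℝ] E4))))) →
      ∃ y : E3, ρin ≤ ‖y‖ ∧ ‖y‖ ≤ ρout ∧
        c₀ * (‖A (E4.basisVector 0)‖ + ‖E4.spatial d‖ + ‖aᵢ • A (E4.basisVector 3)‖) ≤
          ‖MetricCoord.ricAt G' (E4.ofTimeSpace 0 y) - MetricCoord.ricAt G (E4.ofTimeSpace 0 y)‖)
    {g₀ G₀ P₁ P₂ : E4 → E4 →L[ℝ] E4 →L[ℝ] ℝ} {Us : Set E4} {t : ℝ} (hUso : IsOpen Us)
    (hP₂c : ContDiffOn ℝ ∞ P₂ Us) (hP₂s : ∀ z ∈ Us, ∀ u v : E4, P₂ z u v = P₂ z v u)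
    (hslice : ∀ x ∈ Us, x 0 = t → g₀ x = G₀ x ∧
      (∀ v, fderiv ℝ g₀ x v = fderiv ℝ G₀ x v + (v 0) • P₁ x) ∧
      (∀ v w, fderiv ℝ (fderiv ℝ g₀) x v w = fderiv ℝ (fderiv ℝ G₀) x v w +
        (v 0) • fderiv ℝ P₁ x w + (w 0) • fderiv ℝ P₁ x v + (v 0 * w 0) • P₂ x))
    (Λc : ℝ → lorentzGroup) (ξc : ℝ → E3) (L : lorentzGroup) (hL : |((L : E4 ≃L[ℝ] E4) (E4.basisVector 0)) 0| ≤ γ)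
    (hLcol : ∀ x : E4, Kerr.radius aᵢ (poincareInv (Λc t) (E4.ofTimeSpace t (ξc t)) x) =
      Kerr.radius aᵢ (poincareInv L (E4.ofTimeSpace t (ξc t)) x))
    {A' : E4 →L[ℝ] E4} (hA's : ∀ v w : E4, Minkowski.bilin (A' v) w + Minkowski.bilin v (A' w) = 0) (d₂ : E4)
    {T₀ m α r₀ : ℝ} (hm : 0 < m) (hr₀M : r₀ < 2 * Mᵢ)
    (hmetric : MetricCoord.IsMetricOn g₀ {z : E4 | T₀ < z 0 ∧ ‖E4.spatial z - ξc (z 0)‖ < (ρout + 1) ∧ r₀ < Kerr.radius aᵢ (poincareInv (Λc (z 0)) (E4.ofTimeSpace (z 0) (ξc (z 0))) z)})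
    (hfacts : ∀ z : E4, T₀ < z 0 → ‖E4.spatial z - ξc (z 0)‖ ≤ ρout + 1 →
      r₀ ≤ Kerr.radius aᵢ (poincareInv (Λc (z 0)) (E4.ofTimeSpace (z 0) (ξc (z 0))) z) →
      (z 0 = t → z ∈ Us) ∧ (∀ v : E4, m * ‖v‖ ≤ ‖g₀ z v‖) ∧ ‖g₀ z‖ ≤ α)
    {C_J Dsum SE₁ S₂ Werr : ℝ} (hC_J : 0 ≤ C_J) (hDsum : 0 ≤ Dsum) (hSE₁ : 0 ≤ SE₁) (hS₂ : 0 ≤ S₂)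
    (hJ : ∀ x ∈ Us, x 0 = t → ‖x - E4.ofTimeSpace t (ξc t)‖ ≤ ρout →
      2 * Mᵢ ≤ Kerr.radius aᵢ (poincareInv L (E4.ofTimeSpace t (ξc t)) x) →
      (‖fderiv ℝ G₀ x‖ ≤ C_J ∧ ‖fderiv ℝ (fderiv ℝ G₀) x‖ ≤ C_J) ∧
      (‖G₀ x - boostedKerrBilin L (E4.ofTimeSpace t (ξc t)) Mᵢ aᵢ x‖ ≤ C_J * Dsum ∧
        ‖fderiv ℝ G₀ x - fderiv ℝ (boostedKerrBilin L (E4.ofTimeSpace t (ξc t)) Mᵢ aᵢ) x‖ ≤ C_J * Dsum ∧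
        ‖fderiv ℝ (fderiv ℝ G₀) x - fderiv ℝ (fderiv ℝ (boostedKerrBilin L (E4.ofTimeSpace t (ξc t)) Mᵢ aᵢ)) x‖ ≤ C_J * Dsum) ∧
      (‖P₁ x‖ ≤ C_J * SE₁ ∧ ‖fderiv ℝ P₁ x‖ ≤ C_J * SE₁) ∧
      (‖P₂ x - ((fderiv ℝ (Kerr.bilin Mᵢ aᵢ) (poincareInv L 0 (x - E4.ofTimeSpace t (ξc t))) (A' (poincareInv L 0 (x - E4.ofTimeSpace t (ξc t))) + d₂)).bilinearComp (((L : E4 ≃L[ℝ] E4).symm : E4 →L[ℝ] E4)) (((L : E4 ≃L[ℝ] E4).symm : E4 →L[ℝ] E4)) + (Kerr.bilin Mᵢ aᵢ (poincareInv L 0 (x - E4.ofTimeSpace t (ξc t)))).bilinearComp ((A').comp (((L : E4 ≃L[ℝ] E4).symm : E4 →L[ℝ] E4))) (((L : E4 ≃L[ℝ] E4).symm : E4 →L[ℝ] E4)) + (Kerr.bilin Mᵢ aᵢ (poincareInv L 0 (x - E4.ofTimeSpace t (ξc t)))).bilinearComp (((L : E4 ≃L[ℝ] E4).symm : E4 →L[ℝ]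 E4)) ((A').comp (((L : E4 ≃L[ℝ] E4).symm : E4 →L[ℝ] E4))))‖ ≤ C_J * Werr ∧ ‖P₂ x‖ ≤ C_J * S₂))
    {R₁ : ℝ} (hR₁ : C_J * (1 + 2 * SE₁) + 1 ≤ R₁)
    {r L₀ : ℝ} (hL₀ : 0 ≤ L₀)
    (hLip : ∀ j' ∈ (Metric.closedBall (0 : E4) ρout ×ˢ ({A : E4 →L[ℝ] E4 →L[ℝ] ℝ | ‖A‖ ≤ α ∧ ∀ v : E4, m * ‖v‖ ≤ ‖A v‖} ×ˢ (Metric.closedBall (0 : E4 →L[ℝ] E4 →L[ℝ] E4 →L[ℝ] ℝ) R₁ ×ˢ Metric.closedBall (0 : E4 →L[ℝ] E4 →L[ℝ] E4 →L[ℝ] E4 →L[ℝ] ℝ) R₁))), ∀ j, ‖j - j'‖ ≤ r →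
      ‖ricciJet (E := E4) j - ricciJet (E := E4) j'‖ ≤ L₀ * ‖j - j'‖)
    {T₁ ε' : ℝ}
    (hrrc : ∀ x : E4, T₁ < x 0 → ‖E4.spatial x - ξc (x 0)‖ < ρout + 1 →
      r₀ < Kerr.radius aᵢ (poincareInv (Λc (x 0)) (E4.ofTimeSpace (x 0) (ξc (x 0))) x) →
      ∀ l : ℝ, 1 ≤ l → ‖fderiv ℝ g₀ x‖ ≤ l → ‖fderiv ℝ (fderiv ℝ g₀) x‖ ≤ l ^ 2 →
      ‖MetricCoord.ricAt g₀ x‖ ≤ ε' * l ^ 2)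
    (ht₀ : T₀ < t) (ht₁ : T₁ < t) (hclose : C_J * Dsum ≤ η₀) (hδr : C_J * (Dsum + 3 * SE₁) ≤ r) :
    c₀ * (‖A' (E4.basisVector 0)‖ + ‖E4.spatial d₂‖ + ‖aᵢ • A' (E4.basisVector 3)‖) ≤
      4 * m⁻¹ * C_J * Werr + L₀ * (C_J * (Dsum + 3 * SE₁)) + ε' * ((R₁ + C_J + 1) ^ 2 * (1 + S₂)) := by
  -- ### notation
  set c : E4 := E4.ofTimeSpace t (ξc t) with hc
  set K : E4 → E4 →L[ℝ] E4 →L[ℝ] ℝ := boostedKerrBilin L c Mᵢ aᵢ with hK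
  -- ### the translated fields
  set V₀ : Set E4 := {z : E4 | T₀ < z 0 ∧ ‖E4.spatial z - ξc (z 0)‖ < (ρout + 1) ∧ r₀ < Kerr.radius aᵢ (poincareInv (Λc (z 0)) (E4.ofTimeSpace (z 0) (ξc (z 0))) z)} ∩ Us with hV₀
  set G : E4 → E4 →L[ℝ] E4 →L[ℝ] ℝ := fun w ↦ g₀ (w + c) with hGdef
  set P : E4 → E4 →L[ℝ] E4 →L[ℝ] ℝ := fun w ↦ P₂ (w + c) with hPdef
  set V : Set E4 := (fun w ↦ w + c) ⁻¹' V₀ with hV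
  have hV₀o : IsOpen V₀ := hmetric.isOpen.inter hUso
  have hg₀V₀ : IsMetricOn g₀ V₀ := KerrSchildChart.isMetricOn_mono hmetric hV₀o inter_subset_left
  have hGfun : (fun w : E4 ↦ g₀ (c + (1 : ℝ) • w)) = G := funext fun w ↦ by rw [one_smul, add_comm]
  have hVset : ((fun w : E4 ↦ c + (1 : ℝ) • w) ⁻¹' V₀) = V := by
    ext w; simp only [mem_preimage, hV, one_smul, add_comm]
  have hGV : IsMetricOn G V := by
    have hz := isMetricOn_comp_zoom hg₀V₀ c 1
    rw [hGfun, hVset] at hz; exact hz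
  have htr : ContDiff ℝ ∞ (fun w : E4 ↦ w + c) := contDiff_id.add contDiff_const
  have hPV : ContDiffOn ℝ ∞ P V := hP₂c.comp htr.contDiffOn fun w hw ↦ hw.2
  have hPs : ∀ w ∈ V, ∀ u' v', P w u' v' = P w v' u' := fun w hw u' v' ↦ hP₂s (w + c) hw.2 u' v'
  -- ### geometry of the shell points
  have hnemb : ∀ v : E3, ‖E4.ofTimeSpace 0 v‖ = ‖v‖ := fun v ↦ by
    rw [norm_eq_spatialNorm_of_apply_zero_eq_zero (E4.ofTimeSpace_apply_zero _ _), E4.spatialNorm,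
      E4.spatial_ofTimeSpace]
  have hπ : ∀ v : E4, |v 0| ≤ ‖v‖ := Literature.Geometry.Lorentzian.C0Extension.abs_apply_zero_le_norm
  have hpt : ∀ y : E3, ρin ≤ ‖y‖ → ‖y‖ ≤ ρout →
      (E4.ofTimeSpace 0 y + c) 0 = t ∧
      E4.spatial (E4.ofTimeSpace 0 y + c) - ξc ((E4.ofTimeSpace 0 y + c) 0) = y ∧
      poincareInv L c (E4.ofTimeSpace 0 y + c) = poincareInv L 0 (E4.ofTimeSpace 0 y) ∧
      2 * Mᵢ < Kerr.radius aᵢ (poincareInv L 0 (E4.ofTimeSpace 0 y)) ∧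
      r₀ < Kerr.radius aᵢ (poincareInv (Λc t) c (E4.ofTimeSpace 0 y + c)) ∧
      (E4.ofTimeSpace 0 y + c) ∈ V₀ := by
    intro y hy1 hy2
    have hx0 : (E4.ofTimeSpace 0 y + c) 0 = t := by
      show (E4.ofTimeSpace 0 y) 0 + c 0 = t
      rw [hc, E4.ofTimeSpace_apply_zero, E4.ofTimeSpace_apply_zero, zero_add]
    have hsp : E4.spatial (E4.ofTimeSpace 0 y + c) - ξc ((E4.ofTimeSpace 0 y + c) 0) = y := by
      rw [hx0, map_add, hc, E4.spatial_ofTimeSpace, E4.spatial_ofTimeSpace, add_sub_cancel_right]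
    have hpc : poincareInv L c (E4.ofTimeSpace 0 y + c) = poincareInv L 0 (E4.ofTimeSpace 0 y) := by
      simp only [poincareInv, add_sub_cancel_right, sub_zero]
    have hrad : 2 * Mᵢ < Kerr.radius aᵢ (poincareInv L 0 (E4.ofTimeSpace 0 y)) := hshell L y hL hy1
    have hradt : r₀ < Kerr.radius aᵢ (poincareInv (Λc t) c (E4.ofTimeSpace 0 y + c)) := by
      rw [hLcol, hpc]; exact hr₀M.trans hrad
    have htube : (E4.ofTimeSpace 0 y + c) ∈ {z : E4 | T₀ < z 0 ∧ ‖E4.spatial z - ξc (z 0)‖ < (ρout + 1) ∧ r₀ < Kerr.radius aᵢ (poincareInv (Λc (z 0)) (E4.ofTimeSpace (z 0) (ξc (z 0))) z)} := by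
      refine ⟨by rw [hx0]; exact ht₀, by rw [hsp]; linarith only [hy2], ?_⟩
      rw [hx0]; exact hradt
    have hUsx : (E4.ofTimeSpace 0 y + c) ∈ Us :=
      (hfacts _ (by rw [hx0]; exact ht₀) (by rw [hsp]; linarith only [hy2]) (by rw [hx0]; exact hradt.le)).1 hx0
    exact ⟨hx0, hsp, hpc, hrad, hradt, ⟨htube, hUsx⟩⟩
  -- ### `boostedKerrBilin L 0 = K (· + c)`
  have hKfun : (fun w : E4 ↦ K (w + c)) = boostedKerrBilin L 0 Mᵢ aᵢ := by
    funext w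
    have h1 := higherOrder_boostedKerrBilin_sub_eq_omega L 0 Mᵢ aᵢ w
    have h2 := higherOrder_boostedKerrBilin_sub_eq_omega L c Mᵢ aᵢ (w + c)
    rw [sub_zero] at h1
    rw [add_sub_cancel_right] at h2
    have : K (w + c) - Minkowski.bilin = boostedKerrBilin L 0 Mᵢ aᵢ w - Minkowski.bilin := by rw [hK, h2, h1]
    exact sub_left_injective this
  -- ### the hypotheses of the coercivity clause along the shell
  have hVs : ∀ y : E3, ρin ≤ ‖y‖ → ‖y‖ ≤ ρout → E4.ofTimeSpace 0 y ∈ V ∧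
      ‖G (E4.ofTimeSpace 0 y) - boostedKerrBilin L 0 Mᵢ aᵢ (E4.ofTimeSpace 0 y)‖ ≤ η₀ ∧
      0 < Kerr.radius aᵢ (poincareInv L 0 (E4.ofTimeSpace 0 y)) := by
    intro y hy1 hy2
    obtain ⟨hx0, hsp, hpc, hrad, hradt, hV₀x⟩ := hpt y hy1 hy2
    refine ⟨hV₀x, ?_, (mul_pos two_pos hMi).trans hrad⟩
    have hKx : boostedKerrBilin L 0 Mᵢ aᵢ (E4.ofTimeSpace 0 y) = K (E4.ofTimeSpace 0 y + c) := by rw [← hKfun]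
    obtain ⟨hg0, -, -⟩ := hslice _ hV₀x.2 hx0
    have hxc : ‖(E4.ofTimeSpace 0 y + c) - c‖ ≤ ρout := by rw [add_sub_cancel_right, hnemb]; exact hy2
    have h2M : 2 * Mᵢ ≤ Kerr.radius aᵢ (poincareInv L c (E4.ofTimeSpace 0 y + c)) := by rw [hpc]; exact hrad.le
    obtain ⟨-, ⟨hGK0, -, -⟩, -, -⟩ := hJ _ hV₀x.2 hx0 hxc h2M
    show ‖g₀ (E4.ofTimeSpace 0 y + c) - boostedKerrBilin L 0 Mᵢ aᵢ (E4.ofTimeSpace 0 y)‖ ≤ η₀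
    rw [hKx, hg0]
    exact hGK0.trans hclose
  -- ### apply the coercivity clause
  obtain ⟨y, hy1, hy2, V₁, hyV₁, hV₁V, hGV₁, hG₁V₁, j0, j1, j2, hineq⟩ :=
    higherOrder_applyCB₂ hcoer L hL hA's d₂ hGV hVs hPV hPs
  obtain ⟨hx0, hsp, hpc, hrad, hradt, hV₀x⟩ := hpt y hy1 hy2
  set xy : E4 := E4.ofTimeSpace 0 y with hxy
  set x : E4 := xy + c with hx
  have hxyn : ‖xy‖ = ‖y‖ := hnemb y
  -- ### the slice model and the jet bounds at `x`
  obtain ⟨hg0, hg1, hg2⟩ := hslice x hV₀x.2 hx0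
  have hxc : ‖x - c‖ ≤ ρout := by rw [hx, add_sub_cancel_right, hxyn]; exact hy2
  have h2M : 2 * Mᵢ ≤ Kerr.radius aᵢ (poincareInv L c x) := by rw [hpc]; exact hrad.le
  obtain ⟨⟨hB1, hB2⟩, ⟨hGK0, hGK1, hGK2⟩, ⟨hP1a, hP1b⟩, ⟨hW2, hP2a⟩⟩ := hJ x hV₀x.2 hx0 hxc h2M
  have hxcxy : x - c = xy := by rw [hx, add_sub_cancel_right]
  rw [hxcxy] at hW2
  -- ### the jets of `g₀` at `x`: norms
  have hD1n : ‖fderiv ℝ g₀ x‖ ≤ C_J + C_J * SE₁ := by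
    refine ContinuousLinearMap.opNorm_le_bound _ (by positivity) fun v ↦ ?_
    rw [hg1 v]
    calc ‖fderiv ℝ G₀ x v + (v 0) • P₁ x‖ ≤ ‖fderiv ℝ G₀ x v‖ + ‖(v 0) • P₁ x‖ := norm_add_le _ _
      _ ≤ ‖fderiv ℝ G₀ x‖ * ‖v‖ + |v 0| * ‖P₁ x‖ := by
          rw [norm_smul, Real.norm_eq_abs]; exact add_le_add ((fderiv ℝ G₀ x).le_opNorm v) le_rfl
      _ ≤ C_J * ‖v‖ + ‖v‖ * (C_J * SE₁) :=
          add_le_add (mul_le_mul_of_nonneg_right hB1 (norm_nonneg v))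
            (mul_le_mul (hπ v) hP1a (norm_nonneg _) (norm_nonneg _))
      _ = (C_J + C_J * SE₁) * ‖v‖ := by ring
  have hsmb : ∀ v w : E4, ‖(v 0) • fderiv ℝ P₁ x w‖ ≤ (C_J * SE₁) * ‖v‖ * ‖w‖ ∧
      ‖(w 0) • fderiv ℝ P₁ x v‖ ≤ (C_J * SE₁) * ‖v‖ * ‖w‖ := by
    intro v w
    rw [norm_smul, norm_smul, Real.norm_eq_abs, Real.norm_eq_abs]
    constructor
    · calc |v 0| * ‖fderiv ℝ P₁ x w‖ ≤ ‖v‖ * (‖fderiv ℝ P₁ x‖ * ‖w‖) :=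
            mul_le_mul (hπ v) ((fderiv ℝ P₁ x).le_opNorm w) (norm_nonneg _) (norm_nonneg _)
        _ ≤ ‖v‖ * ((C_J * SE₁) * ‖w‖) := by gcongr
        _ = (C_J * SE₁) * ‖v‖ * ‖w‖ := by ring
    · calc |w 0| * ‖fderiv ℝ P₁ x v‖ ≤ ‖w‖ * (‖fderiv ℝ P₁ x‖ * ‖v‖) :=
            mul_le_mul (hπ w) ((fderiv ℝ P₁ x).le_opNorm v) (norm_nonneg _) (norm_nonneg _)
        _ ≤ ‖w‖ * ((C_J * SE₁) * ‖v‖) := by gcongr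
        _ = (C_J * SE₁) * ‖v‖ * ‖w‖ := by ring
  have hD2n : ‖fderiv ℝ (fderiv ℝ g₀) x‖ ≤ C_J + 2 * (C_J * SE₁) + C_J * S₂ := by
    refine ContinuousLinearMap.opNorm_le_bound _ (by positivity) fun v ↦ ?_
    refine ContinuousLinearMap.opNorm_le_bound _ (by positivity) fun w ↦ ?_
    rw [hg2 v w]
    have h1 : ‖fderiv ℝ (fderiv ℝ G₀) x v w‖ ≤ C_J * ‖v‖ * ‖w‖ :=
      ((fderiv ℝ (fderiv ℝ G₀) x v).le_opNorm w).trans (mul_le_mul_of_nonneg_right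
        (((fderiv ℝ (fderiv ℝ G₀) x).le_opNorm v).trans (mul_le_mul_of_nonneg_right hB2 (norm_nonneg _)))
        (norm_nonneg _))
    obtain ⟨h2, h3⟩ := hsmb v w
    have h4 : ‖(v 0 * w 0) • P₂ x‖ ≤ (C_J * S₂) * ‖v‖ * ‖w‖ := by
      rw [norm_smul, Real.norm_eq_abs, abs_mul]
      calc |v 0| * |w 0| * ‖P₂ x‖ ≤ ‖v‖ * ‖w‖ * (C_J * S₂) :=
            mul_le_mul (mul_le_mul (hπ v) (hπ w) (abs_nonneg _) (norm_nonneg _)) hP2a (norm_nonneg _) (by positivity)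
        _ = (C_J * S₂) * ‖v‖ * ‖w‖ := by ring
    calc _ ≤ ‖fderiv ℝ (fderiv ℝ G₀) x v w + (v 0) • fderiv ℝ P₁ x w + (w 0) • fderiv ℝ P₁ x v‖ +
          ‖(v 0 * w 0) • P₂ x‖ := norm_add_le _ _
      _ ≤ ‖fderiv ℝ (fderiv ℝ G₀) x v w‖ + ‖(v 0) • fderiv ℝ P₁ x w‖ + ‖(w 0) • fderiv ℝ P₁ x v‖ +
          ‖(v 0 * w 0) • P₂ x‖ := add_le_add norm_add₃_le le_rfl
      _ ≤ _ := by linarith only [h1, h2, h3, h4]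
  -- ### sizes of the constants
  have hCS : 0 ≤ C_J * SE₁ := mul_nonneg hC_J hSE₁
  have hR₁1 : 1 ≤ R₁ := by linarith only [hR₁, hC_J, hCS]
  have hR₁a : C_J + C_J * SE₁ ≤ R₁ := by linarith only [hR₁, hC_J, hCS]
  have hR₁b : C_J + 2 * (C_J * SE₁) ≤ R₁ := by linarith only [hR₁, hC_J, hCS]
  set Cl : ℝ := (R₁ + C_J + 1) ^ 2 with hCl
  have hb1 : 1 ≤ R₁ + C_J + 1 := by linarith only [hR₁1, hC_J]
  have hClb : R₁ + C_J + 1 ≤ Cl := by rw [hCl]; nlinarith only [hb1]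
  have hCl0 : 0 ≤ Cl := by positivity
  set l : ℝ := Real.sqrt (Cl * (1 + S₂)) with hl
  have hl2 : l ^ 2 = Cl * (1 + S₂) := Real.sq_sqrt (by positivity)
  have hlb : R₁ + C_J + 1 ≤ l := by
    rw [hl]
    calc R₁ + C_J + 1 = Real.sqrt ((R₁ + C_J + 1) ^ 2) := (Real.sqrt_sq (by linarith only [hb1])).symm
      _ ≤ Real.sqrt (Cl * (1 + S₂)) := Real.sqrt_le_sqrt (by
          calc (R₁ + C_J + 1) ^ 2 = Cl * 1 := by rw [hCl, mul_one]
            _ ≤ Cl * (1 + S₂) := mul_le_mul_of_nonneg_left (by linarith only [hS₂]) hCl0)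
  have hl1 : 1 ≤ l := hb1.trans hlb
  have hDl : ‖fderiv ℝ g₀ x‖ ≤ l := hD1n.trans (hR₁a.trans (by linarith only [hlb, hC_J]))
  have hD2l : ‖fderiv ℝ (fderiv ℝ g₀) x‖ ≤ l ^ 2 := by
    rw [hl2]
    refine hD2n.trans ?_
    have k1 : C_J + 2 * (C_J * SE₁) + C_J ≤ Cl := by linarith only [hR₁b, hClb, hC_J]
    have k2 : C_J * S₂ ≤ Cl * S₂ := mul_le_mul_of_nonneg_right (by linarith only [hClb, hR₁1, hC_J]) hS₂
    linarith only [k1, k2, hC_J]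
  -- ### (RR) at `x`
  have hric : ‖ricAt g₀ x‖ ≤ ε' * l ^ 2 :=
    hrrc x (by rw [hx0]; exact ht₁) (by rw [hsp]; linarith only [hy2]) (by rw [hx0]; exact hradt) l hl1 hDl hD2l
  -- ### the Ricci form of the translated field is that of `g₀`
  have hRG : ricAt G xy = ricAt g₀ x := by
    have hmem : c + (1 : ℝ) • xy ∈ V₀ := by rw [one_smul, add_comm]; exact hV₀x
    have h := ricAt_comp_zoom_eq hg₀V₀ one_ne_zero (x := c) (z := xy) hmem
    rw [hGfun] at h
    rw [h, one_pow, one_smul, one_smul, add_comm]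
  -- ### the inverse form and `dx⁰`
  obtain ⟨-, hcoerx, hαx⟩ := hfacts x (by rw [hx0]; exact ht₀) (by rw [hsp]; linarith only [hy2]) (by rw [hx0]; exact hradt.le)
  have hsharp : ‖sharpAt G xy‖ ≤ m⁻¹ :=
    higherOrder_norm_sharpAt_le hm (hGV.isInvertible xy (hV₁V hyV₁)) fun v ↦ hcoerx v
  have hζ1 : ‖(E4.dx 0 : E4 →L[ℝ] ℝ)‖ ≤ 1 := by
    refine ContinuousLinearMap.opNorm_le_bound _ zero_le_one fun w ↦ ?_
    rw [one_mul, Real.norm_eq_abs]; exact hπ w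
  -- ### the frozen own summand, re-centred at the origin
  obtain ⟨hKm, hKric, -⟩ := higherOrder_boostedKerr_reference L 0 Mᵢ aᵢ
  have hxyW : xy ∈ {w : E4 | 0 < Kerr.radius aᵢ (poincareInv L 0 w)} := (mul_pos two_pos hMi).trans hrad
  have hK0 : boostedKerrBilin L 0 Mᵢ aᵢ xy = K x := by rw [← hKfun]
  have hK1 : fderiv ℝ (boostedKerrBilin L 0 Mᵢ aᵢ) xy = fderiv ℝ K x := by
    rw [← hKfun, fderiv_comp_add_right]
  have hK2 : fderiv ℝ (fderiv ℝ (boostedKerrBilin L 0 Mᵢ aᵢ)) xy = fderiv ℝ (fderiv ℝ K) x := by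
    rw [← hKfun, show fderiv ℝ (fun w : E4 ↦ K (w + c)) = fun w ↦ fderiv ℝ K (w + c) from
      funext fun w ↦ fderiv_comp_add_right c, fderiv_comp_add_right]
  -- ### the jets of the translated fields at `x_y`
  have hGxy : G xy = g₀ x := rfl
  have hG1 : fderiv ℝ G xy = fderiv ℝ g₀ x := fderiv_comp_add_right c
  have hG2 : fderiv ℝ (fderiv ℝ G) xy = fderiv ℝ (fderiv ℝ g₀) x := by
    rw [show fderiv ℝ G = fun w ↦ fderiv ℝ g₀ (w + c) from funext fun w ↦ fderiv_comp_add_right c,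
      fderiv_comp_add_right]
  have hPxy : P xy = P₂ x := rfl
  have j2' : ∀ v w, fderiv ℝ (fderiv ℝ (fun w ↦ G w + ((E4.dx 0) w - 0) ^ 2 • ((-(2⁻¹ : ℝ)) • P w))) xy v w =
      fderiv ℝ (fderiv ℝ G₀) x v w + (v 0) • fderiv ℝ P₁ x w + (w 0) • fderiv ℝ P₁ x v := by
    intro v w
    rw [j2 v, _root_.add_apply, hG2, hg2 v w, _root_.smul_apply, ContinuousLinearMap.smulRight_apply, hPxy]
    show _ + (v 0) • ((w 0) • (-P₂ x)) = _
    rw [smul_neg, smul_neg, smul_smul]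
    abel
  -- ### the jet box
  have hjet1 : ‖fderiv ℝ (fun w ↦ G w + ((E4.dx 0) w - 0) ^ 2 • ((-(2⁻¹ : ℝ)) • P w)) xy‖ ≤ R₁ := by rw [j1, hG1]; exact hD1n.trans hR₁a
  have hjet2 : ‖fderiv ℝ (fderiv ℝ (fun w ↦ G w + ((E4.dx 0) w - 0) ^ 2 • ((-(2⁻¹ : ℝ)) • P w))) xy‖ ≤ R₁ := by
    refine le_trans ?_ hR₁b
    refine ContinuousLinearMap.opNorm_le_bound _ (by positivity) fun v ↦ ?_
    refine ContinuousLinearMap.opNorm_le_bound _ (by positivity) fun w ↦ ?_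
    rw [j2' v w]
    have h1 : ‖fderiv ℝ (fderiv ℝ G₀) x v w‖ ≤ C_J * ‖v‖ * ‖w‖ :=
      ((fderiv ℝ (fderiv ℝ G₀) x v).le_opNorm w).trans (mul_le_mul_of_nonneg_right
        (((fderiv ℝ (fderiv ℝ G₀) x).le_opNorm v).trans (mul_le_mul_of_nonneg_right hB2 (norm_nonneg _)))
        (norm_nonneg _))
    obtain ⟨h2, h3⟩ := hsmb v w
    calc _ ≤ ‖fderiv ℝ (fderiv ℝ G₀) x v w‖ + ‖(v 0) • fderiv ℝ P₁ x w‖ + ‖(w 0) • fderiv ℝ P₁ x v‖ :=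
          norm_add₃_le
      _ ≤ _ := by linarith only [h1, h2, h3]
  have hKset : ((xy, (fun w ↦ G w + ((E4.dx 0) w - 0) ^ 2 • ((-(2⁻¹ : ℝ)) • P w)) xy, fderiv ℝ (fun w ↦ G w + ((E4.dx 0) w - 0) ^ 2 • ((-(2⁻¹ : ℝ)) • P w)) xy, fderiv ℝ (fderiv ℝ (fun w ↦ G w + ((E4.dx 0) w - 0) ^ 2 • ((-(2⁻¹ : ℝ)) • P w))) xy)) ∈ (Metric.closedBall (0 : E4) ρout ×ˢ ({A : E4 →L[ℝ] E4 →L[ℝ] ℝ | ‖A‖ ≤ α ∧ ∀ v : E4, m * ‖v‖ ≤ ‖A v‖} ×ˢ (Metric.closedBall (0 : E4 →L[ℝ] E4 →L[ℝ] E4 →L[ℝ] ℝ) R₁ ×ˢ Metric.closedBall (0 : E4 →L[ℝ] E4 →L[ℝ] E4 →L[ℝ] E4 →L[ℝ] ℝ) R₁))) := by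
    refine Set.mk_mem_prod ?_ (Set.mk_mem_prod ?_ (Set.mk_mem_prod ?_ ?_))
    · rw [Metric.mem_closedBall, dist_zero_right, hxyn]; exact hy2
    · rw [j0]; exact ⟨hαx, hcoerx⟩
    · rw [Metric.mem_closedBall, dist_zero_right]; exact hjet1
    · rw [Metric.mem_closedBall, dist_zero_right]; exact hjet2
  -- ### the distance of the jets
  set δ : ℝ := C_J * (Dsum + 3 * SE₁) with hδ
  have hδ0 : 0 ≤ δ := by positivity
  have hd0 : ‖boostedKerrBilin L 0 Mᵢ aᵢ xy - (fun w ↦ G w + ((E4.dx 0) w - 0) ^ 2 • ((-(2⁻¹ : ℝ)) • P w)) xy‖ ≤ δ := by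
    rw [j0, hK0, hGxy, hg0, norm_sub_rev]
    refine hGK0.trans ?_
    rw [hδ]; linarith only [hCS]
  have hd1 : ‖fderiv ℝ (boostedKerrBilin L 0 Mᵢ aᵢ) xy - fderiv ℝ (fun w ↦ G w + ((E4.dx 0) w - 0) ^ 2 • ((-(2⁻¹ : ℝ)) • P w)) xy‖ ≤ δ := by
    rw [j1, hK1, hG1]
    have hb : ‖fderiv ℝ K x - fderiv ℝ g₀ x‖ ≤ C_J * Dsum + C_J * SE₁ := by
      refine ContinuousLinearMap.opNorm_le_bound _ (by positivity) fun v ↦ ?_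
      rw [_root_.sub_apply, hg1 v]
      have e : fderiv ℝ K x v - (fderiv ℝ G₀ x v + (v 0) • P₁ x) =
          -((fderiv ℝ G₀ x - fderiv ℝ K x) v) - (v 0) • P₁ x := by
        rw [_root_.sub_apply]; abel
      rw [e]
      calc ‖-((fderiv ℝ G₀ x - fderiv ℝ K x) v) - (v 0) • P₁ x‖
          ≤ ‖-((fderiv ℝ G₀ x - fderiv ℝ K x) v)‖ + ‖(v 0) • P₁ x‖ := norm_sub_le _ _
        _ ≤ ‖fderiv ℝ G₀ x - fderiv ℝ K x‖ * ‖v‖ + |v 0| * ‖P₁ x‖ := by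
            rw [norm_neg, norm_smul, Real.norm_eq_abs]
            exact add_le_add ((fderiv ℝ G₀ x - fderiv ℝ K x).le_opNorm v) le_rfl
        _ ≤ (C_J * Dsum) * ‖v‖ + ‖v‖ * (C_J * SE₁) :=
            add_le_add (mul_le_mul_of_nonneg_right hGK1 (norm_nonneg v))
              (mul_le_mul (hπ v) hP1a (norm_nonneg _) (norm_nonneg _))
        _ = _ := by ring
    refine hb.trans ?_
    rw [hδ]; linarith only [hCS]
  have hd2 : ‖fderiv ℝ (fderiv ℝ (boostedKerrBilin L 0 Mᵢ aᵢ)) xy - fderiv ℝ (fderiv ℝ (fun w ↦ G w + ((E4.dx 0) w - 0) ^ 2 • ((-(2⁻¹ : ℝ)) • P w))) xy‖ ≤ δ := by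
    rw [hK2]
    have hb : ‖fderiv ℝ (fderiv ℝ K) x - fderiv ℝ (fderiv ℝ (fun w ↦ G w + ((E4.dx 0) w - 0) ^ 2 • ((-(2⁻¹ : ℝ)) • P w))) xy‖ ≤ C_J * Dsum + 2 * (C_J * SE₁) := by
      refine ContinuousLinearMap.opNorm_le_bound _ (by positivity) fun v ↦ ?_
      refine ContinuousLinearMap.opNorm_le_bound _ (by positivity) fun w ↦ ?_
      rw [_root_.sub_apply, _root_.sub_apply, j2' v w]
      have e : fderiv ℝ (fderiv ℝ K) x v w - (fderiv ℝ (fderiv ℝ G₀) x v w + (v 0) • fderiv ℝ P₁ x w +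
          (w 0) • fderiv ℝ P₁ x v) = -((fderiv ℝ (fderiv ℝ G₀) x - fderiv ℝ (fderiv ℝ K) x) v w) -
          (v 0) • fderiv ℝ P₁ x w - (w 0) • fderiv ℝ P₁ x v := by
        rw [_root_.sub_apply, _root_.sub_apply]; abel
      rw [e]
      have h1 : ‖-((fderiv ℝ (fderiv ℝ G₀) x - fderiv ℝ (fderiv ℝ K) x) v w)‖ ≤ (C_J * Dsum) * ‖v‖ * ‖w‖ := by
        rw [norm_neg]
        exact (((fderiv ℝ (fderiv ℝ G₀) x - fderiv ℝ (fderiv ℝ K) x) v).le_opNorm w).trans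
          (mul_le_mul_of_nonneg_right ((((fderiv ℝ (fderiv ℝ G₀) x - fderiv ℝ (fderiv ℝ K) x)).le_opNorm v).trans
            (mul_le_mul_of_nonneg_right hGK2 (norm_nonneg _))) (norm_nonneg _))
      obtain ⟨h2, h3⟩ := hsmb v w
      calc _ ≤ ‖-((fderiv ℝ (fderiv ℝ G₀) x - fderiv ℝ (fderiv ℝ K) x) v w) - (v 0) • fderiv ℝ P₁ x w‖ +
            ‖(w 0) • fderiv ℝ P₁ x v‖ := norm_sub_le _ _
        _ ≤ ‖-((fderiv ℝ (fderiv ℝ G₀) x - fderiv ℝ (fderiv ℝ K) x) v w)‖ + ‖(v 0) • fderiv ℝ P₁ x w‖ +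
            ‖(w 0) • fderiv ℝ P₁ x v‖ := add_le_add (norm_sub_le _ _) le_rfl
        _ ≤ _ := by linarith only [h1, h2, h3]
    refine hb.trans ?_
    rw [hδ]; linarith only [hCS]
  have hRic₁ : ‖ricAt (fun w ↦ G w + ((E4.dx 0) w - 0) ^ 2 • ((-(2⁻¹ : ℝ)) • P w)) xy‖ ≤ L₀ * δ :=
    higherOrder_norm_ricAt_le_of_jets_at (G := boostedKerrBilin L 0 Mᵢ aᵢ) (G' := (fun w ↦ G w + ((E4.dx 0) w - 0) ^ 2 • ((-(2⁻¹ : ℝ)) • P w)))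
      (W := {w : E4 | 0 < Kerr.radius aᵢ (poincareInv L 0 w)}) (W' := V₁) (x := xy)
      (K := (Metric.closedBall (0 : E4) ρout ×ˢ ({A : E4 →L[ℝ] E4 →L[ℝ] ℝ | ‖A‖ ≤ α ∧ ∀ v : E4, m * ‖v‖ ≤ ‖A v‖} ×ˢ (Metric.closedBall (0 : E4 →L[ℝ] E4 →L[ℝ] E4 →L[ℝ] ℝ) R₁ ×ˢ Metric.closedBall (0 : E4 →L[ℝ] E4 →L[ℝ] E4 →L[ℝ] E4 →L[ℝ] ℝ) R₁)))) (r := r) (L₀ := L₀) (δ := δ)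
      hKm hG₁V₁ hxyW hyV₁ (hKric xy hxyW) hL₀ hLip hKset hδ0 hδr hd0 hd1 hd2
  -- ### the modelling error
  have hWP : ‖((fderiv ℝ (Kerr.bilin Mᵢ aᵢ) (poincareInv L 0 xy) (A' (poincareInv L 0 xy) + d₂)).bilinearComp (((L : E4 ≃L[ℝ] E4).symm : E4 →L[ℝ] E4)) (((L : E4 ≃L[ℝ] E4).symm : E4 →L[ℝ] E4)) + (Kerr.bilin Mᵢ aᵢ (poincareInv L 0 xy)).bilinearComp ((A').comp (((L : E4 ≃L[ℝ] E4).symm : E4 →L[ℝ] E4))) (((L : E4 ≃L[ℝ] E4).symm : E4 →L[ℝ] E4)) + (Kerr.bilin Mᵢ aᵢ (poincareInv L 0 xy)).bilinearComp (((L : E4 ≃L[ℝ] E4).symm : E4 →L[ℝ] E4)) ((A').comp (((L : E4 ≃L[ℝ] E4).symm : E4 →L[ℝ] E4)))) - P xy‖ ≤ C_J * Werr := by rw [norm_sub_rev, hPxy]; exact hW2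
  -- ### conclusion
  have hfirst : 4 * ‖sharpAt G xy‖ * ‖(E4.dx 0 : E4 →L[ℝ] ℝ)‖ ^ 2 * ‖((fderiv ℝ (Kerr.bilin Mᵢ aᵢ) (poincareInv L 0 xy) (A' (poincareInv L 0 xy) + d₂)).bilinearComp (((L : E4 ≃L[ℝ] E4).symm : E4 →L[ℝ] E4)) (((L : E4 ≃L[ℝ] E4).symm : E4 →L[ℝ] E4)) + (Kerr.bilin Mᵢ aᵢ (poincareInv L 0 xy)).bilinearComp ((A').comp (((L : E4 ≃L[ℝ] E4).symm : E4 →L[ℝ] E4))) (((L : E4 ≃L[ℝ] E4).symm : E4 →L[ℝ] E4)) + (Kerr.bilin Mᵢ aᵢ (poincareInv L 0 xy)).bilinearComp (((L : E4 ≃L[ℝ] E4).symm : E4 →L[ℝ] E4)) ((A').comp (((L : E4 ≃L[ℝ] E4).symm : E4 →L[ℝ] E4)))) - P xy‖ ≤ 4 * m⁻¹ * C_J * Werr := by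
    have hζ2 : ‖(E4.dx 0 : E4 →L[ℝ] ℝ)‖ ^ 2 ≤ 1 := by nlinarith only [hζ1, norm_nonneg (E4.dx 0 : E4 →L[ℝ] ℝ)]
    calc 4 * ‖sharpAt G xy‖ * ‖(E4.dx 0 : E4 →L[ℝ] ℝ)‖ ^ 2 * ‖((fderiv ℝ (Kerr.bilin Mᵢ aᵢ) (poincareInv L 0 xy) (A' (poincareInv L 0 xy) + d₂)).bilinearComp (((L : E4 ≃L[ℝ] E4).symm : E4 →L[ℝ] E4)) (((L : E4 ≃L[ℝ] E4).symm : E4 →L[ℝ] E4)) + (Kerr.bilin Mᵢ aᵢ (poincareInv L 0 xy)).bilinearComp ((A').comp (((L : E4 ≃L[ℝ] E4).symm : E4 →L[ℝ] E4))) (((L : E4 ≃L[ℝ] E4).symm : E4 →L[ℝ] E4)) + (Kerr.bilin Mᵢ aᵢ (poincareInv L 0 xy)).bilinearComp (((L : E4 ≃L[ℝ] E4).symm : E4 →L[ℝ] E4)) ((A').comp (((L : E4 ≃L[ℝ] E4).symm : E4 →L[ℝ] E4)))) - P xy‖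
        ≤ 4 * m⁻¹ * 1 * (C_J * Werr) := by gcongr
      _ = _ := by ring
  have hRG' : ‖ricAt G xy‖ ≤ ε' * (Cl * (1 + S₂)) := by rw [hRG, ← hl2]; exact hric
  linarith only [hineq, hfirst, hRic₁, hRG']


end Summit.FinalStateConjecture.FinalStateConjecture.Theorems.SublinearIsFree.Slaving

end
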